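import Mathlib
import HarnessLib
import Summits.QuantumFields.YangMills.Theorems.LangevinControlUVFemtoCurvatureTwoPointAxisCovNonneg

/-!
# Crux `FemtoCurvatureTwoPoint` (stmt-QuantumFields-9363, route `LangevinControlUV`):
# reflection-positivity Cauchy–Schwarz for mirror plaquette pairs (part 3 of 4)

Helper for the line `generic-step-gamma-encoding` (lead prover, `--supports stmt-QuantumFields-9363`).
For EVERY compact group `G`, continuous matrix representation `ρ` and torus `(ℤ/L)^d`, and for each of
the three reflections `Θ` whose positivity is proved in the tree (link `θ t = 1 − t` on even `L` at
`β ≥ 0`, site `θ' t = −t` on even `L` at any `β`, odd-torus `θ t = 1 − t` on odd `L ≥ 3` at `β ≥ 0`),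
the discriminant inequality of the positive-semidefinite centred reflection form
(tree `RPCauchySchwarz.covariance_rp_cauchySchwarz`) specialised to two spatial plaquettes `p, p'` of
the positive half: `Cov(P_{θp}, P_{p'})² ≤ Cov(P_{θp}, P_p) · Cov(P_{θp'}, P_{p'})`
(`cov_timeReflect_sq_le_even`, `cov_negReflect_sq_le`, `cov_timeReflect_sq_le_odd`; registered
sub-goal `stub_mirrorPairCauchySchwarz` = the link case in closed form). Part 4
(`…AxisProfileAntitone`) turns these into log-convexity and monotonicity of the crux's axis profile.
-/

noncomputable section

open MeasureTheory
open Literature.MathematicalPhysics.QuantumFieldTheory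

namespace Summit.QuantumFields.YangMills.Theorems.FemtoCurvatureTwoPoint.AxisCovNonneg

section LogConvex

variable {d L N : ℕ} [NeZero d] [NeZero L] {G : Type*} [Group G] [TopologicalSpace G]
  [IsTopologicalGroup G] [CompactSpace G] [MeasurableSpace G] [BorelSpace G]
  (ρ : G →* Matrix (Fin N) (Fin N) ℂ)

omit [NeZero L] [Group G] [TopologicalSpace G] [IsTopologicalGroup G] [CompactSpace G]
  [MeasurableSpace G] [BorelSpace G] in
/-- Positive-time observables form a cone closed under `H + tK`. [folklore] -/
theorem isPositiveTimeObservable_add_mul {H K : GaugeConfig d L G → ℝ}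
    (hH : IsPositiveTimeObservable H) (hK : IsPositiveTimeObservable K) (t : ℝ) :
    IsPositiveTimeObservable (fun U => H U + t * K U) := fun U V hUV => by
  show H U + t * K U = H V + t * K V
  rw [hH U V hUV, hK U V hUV]

omit [NeZero L] [Group G] [TopologicalSpace G] [IsTopologicalGroup G] [CompactSpace G]
  [MeasurableSpace G] [BorelSpace G] in
/-- Positive-time observables are closed under subtracting constants. [folklore] -/
theorem isPositiveTimeObservable_sub_const {H : GaugeConfig d L G → ℝ}
    (hH : IsPositiveTimeObservable H) (c : ℝ) :
    IsPositiveTimeObservable (fun U => H U - c) := fun U V hUV => by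
  show H U - c = H V - c
  rw [hH U V hUV]

omit [NeZero L] [TopologicalSpace G] [IsTopologicalGroup G] [CompactSpace G] [MeasurableSpace G]
  [BorelSpace G] in
/-- A spatial plaquette in the slab `1 ≤ t ≤ L/2` is a positive-time observable. [folklore] -/
theorem isPositiveTimeObservable_plaqRe {p : Plaquette d L} (hp : p.2.1.1 ≠ 0)
    (h1 : 1 ≤ (p.1 0).val) (h2 : (p.1 0).val ≤ L / 2) :
    IsPositiveTimeObservable (fun U : GaugeConfig d L G => WilsonRP.plaqRe ρ U p) := by
  have h := isPositiveTimeObservable_plaqRe_sub ρ (G := G) hp h1 h2 0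
  simpa using h

omit [TopologicalSpace G] [IsTopologicalGroup G] [CompactSpace G] [MeasurableSpace G]
  [BorelSpace G] in
/-- A spatial plaquette in the CLOSED half `0 ≤ t ≤ L/2` depends only on site-positive or shared
links. [folklore] -/
theorem dependsOn_plaqRe_siteHalf {p : Plaquette d L} (hp : p.2.1.1 ≠ 0) (h2 : (p.1 0).val ≤ L / 2) :
    DependsOn (fun U : GaugeConfig d L G => WilsonRP.plaqRe ρ U p)
      ((WilsonSiteRP.sitePosEdges ∪ WilsonSiteRP.sharedEdges : Finset (Edge d L)) :
        Set (Edge d L)) := by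
  intro U V hUV
  refine dependsOn_plaqRe ρ p fun e he => hUV e ?_
  obtain ⟨he2, h0, -⟩ := time_of_mem_edges hp he
  rw [Finset.coe_union, Set.mem_union, Finset.mem_coe, Finset.mem_coe, WilsonSiteRP.mem_sitePosEdges,
    WilsonSiteRP.mem_sharedEdges]
  simp only [WilsonSiteRP.IsSitePosEdge, WilsonSiteRP.IsSharedEdge, he2, ↓reduceIte, h0, ne_eq,
    not_false_eq_true, true_and]
  omega

omit [TopologicalSpace G] [IsTopologicalGroup G] [CompactSpace G] [MeasurableSpace G]
  [BorelSpace G] in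
/-- A spatial plaquette in the closed odd half `1 ≤ t ≤ L/2 + 1` depends only on odd-positive or
odd-shared links. [folklore] -/
theorem dependsOn_plaqRe_oddHalf {p : Plaquette d L} (hp : p.2.1.1 ≠ 0) (h1 : 1 ≤ (p.1 0).val)
    (h2 : (p.1 0).val ≤ L / 2 + 1) :
    DependsOn (fun U : GaugeConfig d L G => WilsonRP.plaqRe ρ U p)
      ((WilsonOddRP.oPosEdges ∪ WilsonOddRP.oSharedEdges : Finset (Edge d L)) :
        Set (Edge d L)) := by
  intro U V hUV
  refine dependsOn_plaqRe ρ p fun e he => hUV e ?_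
  obtain ⟨he2, h0, -⟩ := time_of_mem_edges hp he
  rw [Finset.coe_union, Set.mem_union, Finset.mem_coe, Finset.mem_coe, WilsonOddRP.mem_oPosEdges,
    WilsonOddRP.mem_oSharedEdges]
  simp only [WilsonOddRP.IsOPosEdge, WilsonOddRP.IsOSharedEdge, he2, h0, ne_eq, not_false_eq_true,
    true_and]
  omega

omit [NeZero d] in
/-- Bounded measurable plaquette functions are in `L²` of the Wilson state. [folklore] -/
theorem memLp_plaqRe (hρ : Continuous ρ) (β : ℝ) (p : Plaquette d L) :
    MemLp (fun U : GaugeConfig d L G => WilsonRP.plaqRe ρ U p) 2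
      (wilsonMeasure (d := d) (L := L) ρ β) := by
  haveI := isProbabilityMeasure_wilsonMeasure (d := d) (L := L) ρ hρ β
  exact MemLp.of_bound (WilsonRP.measurable_plaqRe ρ hρ p).aestronglyMeasurable (N : ℝ)
    (ae_of_all _ fun U => by rw [Real.norm_eq_abs]; exact WilsonRP.abs_plaqRe_le ρ hρ U p)

omit [NeZero d] in
/-- The covariance of two plaquette functions in the `E[AB] − E[A]E[B]` form of the crux. [folklore] -/
theorem covariance_plaqRe_eq (hρ : Continuous ρ) (β : ℝ) (p p' : Plaquette d L)
    (Θ : GaugeConfig d L G → GaugeConfig d L G) (hΘm : Measurable Θ) :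
    ProbabilityTheory.covariance (fun U => WilsonRP.plaqRe ρ (Θ U) p) (fun U => WilsonRP.plaqRe ρ U p')
        (wilsonMeasure (d := d) (L := L) ρ β) =
      wilsonExpectation ρ β (fun U : GaugeConfig d L G =>
          WilsonRP.plaqRe ρ (Θ U) p * WilsonRP.plaqRe ρ U p')
        - wilsonExpectation ρ β (fun U : GaugeConfig d L G => WilsonRP.plaqRe ρ (Θ U) p)
          * wilsonExpectation ρ β (fun U : GaugeConfig d L G => WilsonRP.plaqRe ρ U p') := by
  haveI := isProbabilityMeasure_wilsonMeasure (d := d) (L := L) ρ hρ β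
  have h1 : MemLp (fun U : GaugeConfig d L G => WilsonRP.plaqRe ρ (Θ U) p) 2
      (wilsonMeasure (d := d) (L := L) ρ β) :=
    MemLp.of_bound ((WilsonRP.measurable_plaqRe ρ hρ p).comp hΘm).aestronglyMeasurable (N : ℝ)
      (ae_of_all _ fun U => by rw [Real.norm_eq_abs]; exact WilsonRP.abs_plaqRe_le ρ hρ _ p)
  rw [ProbabilityTheory.covariance_eq_sub h1 (memLp_plaqRe ρ hρ β p')]
  rfl

/-- **Reflection-positivity Cauchy–Schwarz for link-mirror plaquettes** (`L` even, `β ≥ 0`): for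
spatial plaquettes `p, p'` in the slab `1 ≤ t ≤ L/2`,
`Cov(P_{θp}, P_{p'})² ≤ Cov(P_{θp}, P_p) · Cov(P_{θp'}, P_{p'})`. [folklore] -/
theorem cov_timeReflect_sq_le_even (hL : Even L) (hρ : Continuous ρ) {β : ℝ} (hβ : 0 ≤ β)
    {p p' : Plaquette d L} (hp : p.2.1.1 ≠ 0) (h1 : 1 ≤ (p.1 0).val) (h2 : (p.1 0).val ≤ L / 2)
    (hp' : p'.2.1.1 ≠ 0) (h1' : 1 ≤ (p'.1 0).val) (h2' : (p'.1 0).val ≤ L / 2) :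
    (wilsonExpectation ρ β (fun U : GaugeConfig d L G =>
          WilsonRP.plaqRe ρ U (p.1.timeReflect, p.2) * WilsonRP.plaqRe ρ U p')
        - wilsonExpectation ρ β (fun U : GaugeConfig d L G =>
            WilsonRP.plaqRe ρ U (p.1.timeReflect, p.2))
          * wilsonExpectation ρ β (fun U : GaugeConfig d L G => WilsonRP.plaqRe ρ U p')) ^ 2 ≤
      (wilsonExpectation ρ β (fun U : GaugeConfig d L G =>
          WilsonRP.plaqRe ρ U (p.1.timeReflect, p.2) * WilsonRP.plaqRe ρ U p)
        - wilsonExpectation ρ β (fun U : GaugeConfig d L G =>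
            WilsonRP.plaqRe ρ U (p.1.timeReflect, p.2))
          * wilsonExpectation ρ β (fun U : GaugeConfig d L G => WilsonRP.plaqRe ρ U p)) *
      (wilsonExpectation ρ β (fun U : GaugeConfig d L G =>
          WilsonRP.plaqRe ρ U (p'.1.timeReflect, p'.2) * WilsonRP.plaqRe ρ U p')
        - wilsonExpectation ρ β (fun U : GaugeConfig d L G =>
            WilsonRP.plaqRe ρ U (p'.1.timeReflect, p'.2))
          * wilsonExpectation ρ β (fun U : GaugeConfig d L G => WilsonRP.plaqRe ρ U p')) := by
  haveI := isProbabilityMeasure_wilsonMeasure (d := d) (L := L) ρ hρ β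
  have key := FiniteSusceptibilityWeakCoupling.RPCauchySchwarz.covariance_rp_cauchySchwarz
    (μ := wilsonMeasure (d := d) (L := L) ρ β) (Θ := GaugeConfig.timeReflect)
    (D := fun H : GaugeConfig d L G → ℝ => IsPositiveTimeObservable H)
    WilsonRP.measurable_timeReflect
    (FiniteSusceptibilityWeakCoupling.RPCauchySchwarz.wilsonMeasure_map_timeReflect ρ hρ β)
    FiniteSusceptibilityWeakCoupling.RPCauchySchwarz.timeReflect_timeReflect
    (fun H hH hHb hHD => integral_timeReflect_mul_nonneg_even ρ hL hρ hβ H hH hHb hHD)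
    (fun H K t hH hK => isPositiveTimeObservable_add_mul hH hK t)
    (fun H c hH => isPositiveTimeObservable_sub_const hH c)
    (WilsonRP.measurable_plaqRe ρ hρ p) (WilsonRP.measurable_plaqRe ρ hρ p')
    ⟨N, fun U => WilsonRP.abs_plaqRe_le ρ hρ U p⟩ ⟨N, fun U => WilsonRP.abs_plaqRe_le ρ hρ U p'⟩
    (isPositiveTimeObservable_plaqRe ρ hp h1 h2) (isPositiveTimeObservable_plaqRe ρ hp' h1' h2')
  obtain ⟨-, -, hcs⟩ := key
  have hrefl : ∀ (q : Plaquette d L), q.2.1.1 ≠ 0 → ∀ U : GaugeConfig d L G,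
      WilsonRP.plaqRe ρ U.timeReflect q = WilsonRP.plaqRe ρ U (q.1.timeReflect, q.2) := fun q hq U => by
    rw [WilsonRP.plaqRe_timeReflect ρ hρ U q, plaqReflect_of_ne hq]
  rw [covariance_plaqRe_eq ρ hρ β p p' _ WilsonRP.measurable_timeReflect,
    covariance_plaqRe_eq ρ hρ β p p _ WilsonRP.measurable_timeReflect,
    covariance_plaqRe_eq ρ hρ β p' p' _ WilsonRP.measurable_timeReflect] at hcs
  simpa only [hrefl p hp, hrefl p' hp'] using hcs

/-- **Reflection-positivity Cauchy–Schwarz for site-mirror plaquettes** (`L` even, any `β`): for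
spatial plaquettes `p, p'` in the closed half `0 ≤ t ≤ L/2`,
`Cov(P_{θ'p}, P_{p'})² ≤ Cov(P_{θ'p}, P_p) · Cov(P_{θ'p'}, P_{p'})`. [folklore] -/
theorem cov_negReflect_sq_le (hL : Even L) (hρ : Continuous ρ) (β : ℝ)
    {p p' : Plaquette d L} (hp : p.2.1.1 ≠ 0) (h2 : (p.1 0).val ≤ L / 2)
    (hp' : p'.2.1.1 ≠ 0) (h2' : (p'.1 0).val ≤ L / 2) :
    (wilsonExpectation ρ β (fun U : GaugeConfig d L G =>
          WilsonRP.plaqRe ρ U (p.1.negReflect, p.2) * WilsonRP.plaqRe ρ U p')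
        - wilsonExpectation ρ β (fun U : GaugeConfig d L G =>
            WilsonRP.plaqRe ρ U (p.1.negReflect, p.2))
          * wilsonExpectation ρ β (fun U : GaugeConfig d L G => WilsonRP.plaqRe ρ U p')) ^ 2 ≤
      (wilsonExpectation ρ β (fun U : GaugeConfig d L G =>
          WilsonRP.plaqRe ρ U (p.1.negReflect, p.2) * WilsonRP.plaqRe ρ U p)
        - wilsonExpectation ρ β (fun U : GaugeConfig d L G =>
            WilsonRP.plaqRe ρ U (p.1.negReflect, p.2))
          * wilsonExpectation ρ β (fun U : GaugeConfig d L G => WilsonRP.plaqRe ρ U p)) *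
      (wilsonExpectation ρ β (fun U : GaugeConfig d L G =>
          WilsonRP.plaqRe ρ U (p'.1.negReflect, p'.2) * WilsonRP.plaqRe ρ U p')
        - wilsonExpectation ρ β (fun U : GaugeConfig d L G =>
            WilsonRP.plaqRe ρ U (p'.1.negReflect, p'.2))
          * wilsonExpectation ρ β (fun U : GaugeConfig d L G => WilsonRP.plaqRe ρ U p')) := by
  haveI := isProbabilityMeasure_wilsonMeasure (d := d) (L := L) ρ hρ β
  haveI : Fact (1 < L) := ⟨by obtain ⟨r, hr⟩ := hL; have := NeZero.ne L; omega⟩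
  have key := FiniteSusceptibilityWeakCoupling.RPCauchySchwarz.covariance_rp_cauchySchwarz
    (μ := wilsonMeasure (d := d) (L := L) ρ β) (Θ := GaugeConfig.negReflect)
    (D := fun H : GaugeConfig d L G → ℝ => DependsOn H
      ((WilsonSiteRP.sitePosEdges ∪ WilsonSiteRP.sharedEdges : Finset (Edge d L)) : Set (Edge d L)))
    WilsonSiteRP.measurable_negReflect (WilsonSiteRP.wilsonMeasure_map_negReflect ρ hL hρ β)
    WilsonSiteRP.negReflect_negReflect_config
    (fun H hH hHb hHD => integral_negReflect_mul_nonneg ρ hL hρ β H hH hHb hHD)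
    (fun H K t hH hK => FiniteSusceptibilityWeakCoupling.RPCauchySchwarz.dependsOn_add_mul hH hK t)
    (fun H c hH => FiniteSusceptibilityWeakCoupling.RPCauchySchwarz.dependsOn_sub_const hH c)
    (WilsonRP.measurable_plaqRe ρ hρ p) (WilsonRP.measurable_plaqRe ρ hρ p')
    ⟨N, fun U => WilsonRP.abs_plaqRe_le ρ hρ U p⟩ ⟨N, fun U => WilsonRP.abs_plaqRe_le ρ hρ U p'⟩
    (dependsOn_plaqRe_siteHalf ρ hp h2) (dependsOn_plaqRe_siteHalf ρ hp' h2')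
  obtain ⟨-, -, hcs⟩ := key
  have hrefl : ∀ (q : Plaquette d L), q.2.1.1 ≠ 0 → ∀ U : GaugeConfig d L G,
      WilsonRP.plaqRe ρ U.negReflect q = WilsonRP.plaqRe ρ U (q.1.negReflect, q.2) := fun q hq U => by
    rw [WilsonSiteRP.plaqRe_negReflect ρ hρ U q, sitePlaqReflect_of_ne hq]
  rw [covariance_plaqRe_eq ρ hρ β p p' _ WilsonSiteRP.measurable_negReflect,
    covariance_plaqRe_eq ρ hρ β p p _ WilsonSiteRP.measurable_negReflect,
    covariance_plaqRe_eq ρ hρ β p' p' _ WilsonSiteRP.measurable_negReflect] at hcs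
  simpa only [hrefl p hp, hrefl p' hp'] using hcs

/-- **Reflection-positivity Cauchy–Schwarz for odd-torus mirror plaquettes** (`L` odd, `L ≥ 3`,
`β ≥ 0`): for spatial plaquettes `p, p'` in the closed odd half `1 ≤ t ≤ L/2 + 1`,
`Cov(P_{θp}, P_{p'})² ≤ Cov(P_{θp}, P_p) · Cov(P_{θp'}, P_{p'})`. [folklore] -/
theorem cov_timeReflect_sq_le_odd (hL : Odd L) (hL3 : 3 ≤ L) (hρ : Continuous ρ) {β : ℝ}
    (hβ : 0 ≤ β) {p p' : Plaquette d L} (hp : p.2.1.1 ≠ 0) (h1 : 1 ≤ (p.1 0).val)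
    (h2 : (p.1 0).val ≤ L / 2 + 1) (hp' : p'.2.1.1 ≠ 0) (h1' : 1 ≤ (p'.1 0).val)
    (h2' : (p'.1 0).val ≤ L / 2 + 1) :
    (wilsonExpectation ρ β (fun U : GaugeConfig d L G =>
          WilsonRP.plaqRe ρ U (p.1.timeReflect, p.2) * WilsonRP.plaqRe ρ U p')
        - wilsonExpectation ρ β (fun U : GaugeConfig d L G =>
            WilsonRP.plaqRe ρ U (p.1.timeReflect, p.2))
          * wilsonExpectation ρ β (fun U : GaugeConfig d L G => WilsonRP.plaqRe ρ U p')) ^ 2 ≤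
      (wilsonExpectation ρ β (fun U : GaugeConfig d L G =>
          WilsonRP.plaqRe ρ U (p.1.timeReflect, p.2) * WilsonRP.plaqRe ρ U p)
        - wilsonExpectation ρ β (fun U : GaugeConfig d L G =>
            WilsonRP.plaqRe ρ U (p.1.timeReflect, p.2))
          * wilsonExpectation ρ β (fun U : GaugeConfig d L G => WilsonRP.plaqRe ρ U p)) *
      (wilsonExpectation ρ β (fun U : GaugeConfig d L G =>
          WilsonRP.plaqRe ρ U (p'.1.timeReflect, p'.2) * WilsonRP.plaqRe ρ U p')
        - wilsonExpectation ρ β (fun U : GaugeConfig d L G =>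
            WilsonRP.plaqRe ρ U (p'.1.timeReflect, p'.2))
          * wilsonExpectation ρ β (fun U : GaugeConfig d L G => WilsonRP.plaqRe ρ U p')) := by
  haveI := isProbabilityMeasure_wilsonMeasure (d := d) (L := L) ρ hρ β
  have key := FiniteSusceptibilityWeakCoupling.RPCauchySchwarz.covariance_rp_cauchySchwarz
    (μ := wilsonMeasure (d := d) (L := L) ρ β) (Θ := GaugeConfig.timeReflect)
    (D := fun H : GaugeConfig d L G → ℝ => DependsOn H
      ((WilsonOddRP.oPosEdges ∪ WilsonOddRP.oSharedEdges : Finset (Edge d L)) : Set (Edge d L)))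
    WilsonRP.measurable_timeReflect
    (FiniteSusceptibilityWeakCoupling.RPCauchySchwarz.wilsonMeasure_map_timeReflect ρ hρ β)
    FiniteSusceptibilityWeakCoupling.RPCauchySchwarz.timeReflect_timeReflect
    (fun H hH hHb hHD => integral_timeReflect_mul_nonneg_odd ρ hL hL3 hρ hβ H hH hHb hHD)
    (fun H K t hH hK => FiniteSusceptibilityWeakCoupling.RPCauchySchwarz.dependsOn_add_mul hH hK t)
    (fun H c hH => FiniteSusceptibilityWeakCoupling.RPCauchySchwarz.dependsOn_sub_const hH c)
    (WilsonRP.measurable_plaqRe ρ hρ p) (WilsonRP.measurable_plaqRe ρ hρ p')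
    ⟨N, fun U => WilsonRP.abs_plaqRe_le ρ hρ U p⟩ ⟨N, fun U => WilsonRP.abs_plaqRe_le ρ hρ U p'⟩
    (dependsOn_plaqRe_oddHalf ρ hp h1 h2) (dependsOn_plaqRe_oddHalf ρ hp' h1' h2')
  obtain ⟨-, -, hcs⟩ := key
  have hrefl : ∀ (q : Plaquette d L), q.2.1.1 ≠ 0 → ∀ U : GaugeConfig d L G,
      WilsonRP.plaqRe ρ U.timeReflect q = WilsonRP.plaqRe ρ U (q.1.timeReflect, q.2) := fun q hq U => by
    rw [WilsonRP.plaqRe_timeReflect ρ hρ U q, plaqReflect_of_ne hq]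
  rw [covariance_plaqRe_eq ρ hρ β p p' _ WilsonRP.measurable_timeReflect,
    covariance_plaqRe_eq ρ hρ β p p _ WilsonRP.measurable_timeReflect,
    covariance_plaqRe_eq ρ hρ β p' p' _ WilsonRP.measurable_timeReflect] at hcs
  simpa only [hrefl p hp, hrefl p' hp'] using hcs

end LogConvex

end Summit.QuantumFields.YangMills.Theorems.FemtoCurvatureTwoPoint.AxisCovNonneg

namespace Summit.QuantumFields.YangMills.Theorems.FemtoCurvatureTwoPoint

/-- **Registered sub-goal `stub_mirrorPairCauchySchwarz`** (`--supports stmt-QuantumFields-9363`):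
reflection-positivity Cauchy–Schwarz for link-mirror plaquette pairs on even tori at `β ≥ 0` (closed
form of `AxisCovNonneg.cov_timeReflect_sq_le_even`, fully qualified). [folklore] -/
theorem stub_mirrorPairCauchySchwarz : ∀ (d L N : ℕ) [NeZero d] [NeZero L] (G : Type) [Group G] [TopologicalSpace G] [IsTopologicalGroup G] [CompactSpace G] [MeasurableSpace G] [BorelSpace G] (ρ : G →* Matrix (Fin N) (Fin N) ℂ), Continuous ρ → Even L → ∀ (β : ℝ), 0 ≤ β → ∀ (p p' : Literature.MathematicalPhysics.QuantumFieldTheory.Plaquette d L), p.2.1.1 ≠ 0 → 1 ≤ (p.1 0).val → (p.1 0).val ≤ L / 2 → p'.2.1.1 ≠ 0 → 1 ≤ (p'.1 0).val → (p'.1 0).val ≤ L / 2 → (Literature.MathematicalPhysics.QuantumFieldTheory.wilsonExpectation ρ β (fun U : Literature.MathematicalPhysics.QuantumFieldTheory.GaugeConfig d L G => Literature.MathematicalPhysics.QuantumFieldTheory.WilsonRP.plaqRe ρ U (Literature.MathematicalPhysics.QuantumFieldTheory.Site.timeReflect p.1, p.2) * Literature.MathematicalPhysics.QuantumFieldTheory.WilsonRP.plaqRe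 ρ U p') - Literature.MathematicalPhysics.QuantumFieldTheory.wilsonExpectation ρ β (fun U : Literature.MathematicalPhysics.QuantumFieldTheory.GaugeConfig d L G => Literature.MathematicalPhysics.QuantumFieldTheory.WilsonRP.plaqRe ρ U (Literature.MathematicalPhysics.QuantumFieldTheory.Site.timeReflect p.1, p.2)) * Literature.MathematicalPhysics.QuantumFieldTheory.wilsonExpectation ρ β (fun U : Literature.MathematicalPhysics.QuantumFieldTheory.GaugeConfig d L G => Literature.MathematicalPhysics.QuantumFieldTheory.WilsonRP.plaqRe ρ U p')) ^ 2 ≤ (Literature.MathematicalPhysics.QuantumFieldTheory.wilsonExpectation ρ β (fun U : Literature.MathematicalPhysics.QuantumFieldTheory.GaugeConfig d L G => Literature.MathematicalPhysics.QuantumFieldTheory.WilsonRP.plaqRe ρ U (Literature.MathematicalPhysics.QuantumFieldTheory.Site.timeReflect p.1, p.2) * Literature.MathematicalPhysics.QuantumFieldTheory.WilsonRP.plaqRe ρ U p) - Literature.MathematicalPhysics.QuantumFieldTheory.wilsonExpectation ρ β (fun U : Literature.MathematicalPhysics.QuantumFieldTheory.GaugeConfig d L G => Literature.MathematicalPhysics.QuantumFieldTheory.WilsonRP.plaqRe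 ρ U (Literature.MathematicalPhysics.QuantumFieldTheory.Site.timeReflect p.1, p.2)) * Literature.MathematicalPhysics.QuantumFieldTheory.wilsonExpectation ρ β (fun U : Literature.MathematicalPhysics.QuantumFieldTheory.GaugeConfig d L G => Literature.MathematicalPhysics.QuantumFieldTheory.WilsonRP.plaqRe ρ U p)) * (Literature.MathematicalPhysics.QuantumFieldTheory.wilsonExpectation ρ β (fun U : Literature.MathematicalPhysics.QuantumFieldTheory.GaugeConfig d L G => Literature.MathematicalPhysics.QuantumFieldTheory.WilsonRP.plaqRe ρ U (Literature.MathematicalPhysics.QuantumFieldTheory.Site.timeReflect p'.1, p'.2) * Literature.MathematicalPhysics.QuantumFieldTheory.WilsonRP.plaqRe ρ U p') - Literature.MathematicalPhysics.QuantumFieldTheory.wilsonExpectation ρ β (fun U : Literature.MathematicalPhysics.QuantumFieldTheory.GaugeConfig d L G => Literature.MathematicalPhysics.QuantumFieldTheory.WilsonRP.plaqRe ρ U (Literature.MathematicalPhysics.QuantumFieldTheory.Site.timeReflect p'.1, p'.2)) * Literature.MathematicalPhysics.QuantumFieldTheory.wilsonExpectation ρ β (fun U : Literature.MathematicalPhysics.QuantumFieldTheory.GaugeConfig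 d L G => Literature.MathematicalPhysics.QuantumFieldTheory.WilsonRP.plaqRe ρ U p')) := by
  intro d L N _ _ G _ _ _ _ _ _ ρ hρ hL β hβ p p' hp h1 h2 hp' h1' h2'
  exact AxisCovNonneg.cov_timeReflect_sq_le_even ρ hL hρ hβ hp h1 h2 hp' h1' h2'

end Summit.QuantumFields.YangMills.Theorems.FemtoCurvatureTwoPoint

end
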